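import Mathlib.Data.Nat.Choose.Basic
import Mathlib.Tactic

/-!
# PercRepro — THE ARITHMETIC OF THE DEPENDENT-`4`-SET CAP (p1, gen 40)

`B(ν, n) := C(ν + 1, 4) + (n − ν − 1)·C(ν + 1, 3) + C(ν + 1, 2)` and the cap of S1CFGDepFour is
`D₄ ≤ B(ν, n) + (n − 3)`. The induction on `ν` (from `w` to `w + 1`) needs:
* `depFour_small` — `C(n, 4) ≤ B(ν, n) + (n − 3)` for `n ≤ ν + 3` (rank `≤ 3`: every `4`-set counts; Vandermonde
  `C(ν + 3, 4) = C(ν + 1, 4) + 2·C(ν + 1, 3) + C(ν + 1, 2)`);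
* `depFour_caseB` — the averaging step: `n·(B(w, n − 1) + (n − 4)) ≤ (n − 4)·(B(w + 1, n) + (n − 3))` for `w ≥ 2`,
  `n ≥ w + 5` (the difference is `C(w + 1, 2)·(s² + 5s + 2) + (w − 2)·(w + s + 1)`, `s = n − w − 5`);
* `depFour_caseA` / `depFour_caseA_crude` — the series-class step: with `D ≤ D' + z·c₃' + extra`,
  `D' ≤ B(w, m) + (m − 3)`, `m + z = n`, the bound `D ≤ B(w + 1, n) + (n − 3)` follows from
  `c₃' ≤ C(w + 1, 3) + 1` and `extra ≤ (n − w − 2)·C(w + 1, 2) + w + 1` (the `b`-terms cancel exactly), or from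
  `m = w + 2`, `c₃' ≤ C(w + 2, 3)` and `extra ≤ n − 1`;
* `extra_two_le`, `extra_three_le` — the `extra` bounds of the cases `|Z| = 2` (`(n − 3) + q` with
  `2q ≤ (n − 2)(w)`) and `|Z| = 3` (`n − 3`);
* `depFour_base` — the base `ν = 2`: `2(n − 3) + n/(n − 4) ≤ 2n − 3` for `n ≥ 6`, and `C(n, 4) ≤ 2n − 3` for `n ≤ 5`.
Nothing about any cell is claimed. Axioms: standard.
-/

namespace PercRepro

namespace S1CFG

/-- `4·C(w + 1, 4) = (w − 2)·C(w + 1, 3)`, `3·C(w + 1, 3) = (w − 1)·C(w + 1, 2)`, `2·C(w + 1, 2) = (w + 1)·w`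
(as equalities with `w = t + 2`). -/
theorem choose_relations (t : ℕ) :
    (t + 3).choose 4 * 4 = (t + 3).choose 3 * t ∧ (t + 3).choose 3 * 3 = (t + 3).choose 2 * (t + 1) ∧
      (t + 3).choose 2 * 2 = (t + 3) * (t + 2) := by
  refine ⟨?_, ?_, ?_⟩
  · have := Nat.choose_succ_right_eq (t + 3) 3
    simpa using this
  · have := Nat.choose_succ_right_eq (t + 3) 2
    simpa using this
  · have := Nat.choose_succ_right_eq (t + 3) 1
    simp only [Nat.choose_one_right] at this
    have h : t + 3 - 1 = t + 2 := by omega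
    rw [h] at this
    exact this

/-- Pascal for the three binomials: `C(w + 2, k) = C(w + 1, k) + C(w + 1, k − 1)`. -/
theorem choose_pascal (w : ℕ) :
    (w + 2).choose 4 = (w + 1).choose 4 + (w + 1).choose 3 ∧
      (w + 2).choose 3 = (w + 1).choose 3 + (w + 1).choose 2 ∧
      (w + 2).choose 2 = (w + 1).choose 2 + (w + 1) := by
  refine ⟨?_, ?_, ?_⟩
  · have h : (w + 2).choose 4 = (w + 1).choose 3 + (w + 1).choose 4 := Nat.choose_succ_succ' (w + 1) 3
    omega
  · have h : (w + 2).choose 3 = (w + 1).choose 2 + (w + 1).choose 3 := Nat.choose_succ_succ' (w + 1) 2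
    omega
  · have h : (w + 2).choose 2 = (w + 1).choose 1 + (w + 1).choose 2 := Nat.choose_succ_succ' (w + 1) 1
    rw [Nat.choose_one_right] at h
    omega

/-- **THE SMALL CASE** `n ≤ ν + 3`: `C(n, 4) ≤ B(ν, n) + (n − 3)`. -/
theorem depFour_small {ν n : ℕ} (hn : n ≤ ν + 3) :
    n.choose 4 ≤ (ν + 1).choose 4 + (n - ν - 1) * (ν + 1).choose 3 + (ν + 1).choose 2 + (n - 3) := by
  obtain ⟨h1, h2, h3⟩ := choose_pascal ν
  obtain ⟨h1', h2', h3'⟩ := choose_pascal (ν + 1)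
  rcases Nat.lt_or_ge n (ν + 2) with hlt | hge
  · -- `n ≤ ν + 1`: `C(n, 4) ≤ C(ν + 1, 4)`
    have := Nat.choose_le_choose 4 (show n ≤ ν + 1 by omega)
    omega
  rcases Nat.lt_or_ge n (ν + 3) with hlt | hge'
  · -- `n = ν + 2`: `C(ν + 2, 4) = C(ν + 1, 4) + C(ν + 1, 3)`
    have hn' : n = ν + 2 := by omega
    subst hn'
    have : ν + 2 - ν - 1 = 1 := by omega
    rw [this]
    omega
  · -- `n = ν + 3`: Vandermonde
    have hn' : n = ν + 3 := by omega
    subst hn'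
    have : ν + 3 - ν - 1 = 2 := by omega
    rw [this]
    have e1 : (ν + 3).choose 4 = (ν + 2).choose 3 + (ν + 2).choose 4 := Nat.choose_succ_succ' (ν + 2) 3
    omega

/-- **THE AVERAGING STEP** (`w ≥ 2`, `n ≥ w + 5`):
`n·(B(w, n − 1) + (n − 4)) ≤ (n − 4)·(B(w + 1, n) + (n − 3))`. -/
theorem depFour_caseB {w n : ℕ} (hw : 2 ≤ w) (hn : w + 5 ≤ n) :
    n * ((w + 1).choose 4 + (n - 1 - w - 1) * (w + 1).choose 3 + (w + 1).choose 2 + (n - 1 - 3)) ≤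
      (n - 4) * ((w + 2).choose 4 + (n - (w + 1) - 1) * (w + 2).choose 3 + (w + 2).choose 2 + (n - 3)) := by
  obtain ⟨t, rfl⟩ : ∃ t, w = t + 2 := ⟨w - 2, by omega⟩
  obtain ⟨s, rfl⟩ : ∃ s, n = t + s + 7 := ⟨n - t - 7, by omega⟩
  obtain ⟨h4, h3, h2⟩ := choose_relations t
  obtain ⟨p4, p3, p2⟩ := choose_pascal (t + 2)
  have e1 : t + s + 7 - 1 - (t + 2) - 1 = s + 3 := by omega
  have e2 : t + s + 7 - 1 - 3 = t + s + 3 := by omega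
  have e3 : t + s + 7 - 4 = t + s + 3 := by omega
  have e4 : t + s + 7 - (t + 2 + 1) - 1 = s + 3 := by omega
  have e5 : t + s + 7 - 3 = t + s + 4 := by omega
  rw [e1, e2, e3, e4, e5, show t + 2 + 1 = t + 3 by rfl, show t + 2 + 2 = t + 4 by rfl] at *
  rw [p4, p3, p2]
  set a := (t + 3).choose 4
  set b := (t + 3).choose 3
  set c := (t + 3).choose 2
  zify at h4 h3 h2 ⊢
  have key : ((t + s + 3 : ℕ) : ℤ) * ((a + b) + (s + 3) * (b + c) + (c + (t + 3)) + (t + s + 4)) -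
      ((t + s + 7 : ℕ) : ℤ) * (a + (s + 3) * b + c + (t + s + 3)) =
      c * (s * s + 5 * s + 2) + t * (t + s + 3) := by
    push_cast
    linear_combination (-1 : ℤ) * h4 - ((s : ℤ) + 3) * h3
  have hnn : (0 : ℤ) ≤ c * (s * s + 5 * s + 2) + t * (t + s + 3) := by positivity
  push_cast at key ⊢
  linarith

/-- **THE SERIES-CLASS STEP** (main sub-case `m ≥ w + 3`): from `D ≤ D' + z·c₃' + extra`, `D' ≤ B(w, m) + (m − 3)`,
`c₃' ≤ C(w + 1, 3) + 1` and `extra ≤ (n − w − 2)·C(w + 1, 2) + (w + 1)` (`m + z = n`), conclude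
`D ≤ B(w + 1, n) + (n − 3)`. -/
theorem depFour_caseA {w n m z D D' c₃' extra : ℕ} (hmz : m + z = n) (hm : w + 3 ≤ m)
    (hD : D ≤ D' + z * c₃' + extra)
    (hD' : D' ≤ (w + 1).choose 4 + (m - w - 1) * (w + 1).choose 3 + (w + 1).choose 2 + (m - 3))
    (hc : c₃' ≤ (w + 1).choose 3 + 1)
    (hextra : extra ≤ (n - w - 2) * (w + 1).choose 2 + (w + 1)) :
    D ≤ (w + 2).choose 4 + (n - (w + 1) - 1) * (w + 2).choose 3 + (w + 2).choose 2 + (n - 3) := by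
  obtain ⟨p4, p3, p2⟩ := choose_pascal w
  rw [p4, p3, p2]
  obtain ⟨k, rfl⟩ : ∃ k, m = w + 3 + k := ⟨m - w - 3, by omega⟩
  subst hmz
  have e1 : w + 3 + k - w - 1 = k + 2 := by omega
  have e2 : w + 3 + k - 3 = w + k := by omega
  have e3 : w + 3 + k + z - (w + 1) - 1 = k + z + 1 := by omega
  have e4 : w + 3 + k + z - w - 2 = k + z + 1 := by omega
  have e5 : w + 3 + k + z - 3 = w + k + z := by omega
  rw [e1, e2] at hD'
  rw [e4] at hextra
  rw [e3, e5]
  set a := (w + 1).choose 4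
  set b := (w + 1).choose 3
  set c := (w + 1).choose 2
  have h1 : z * c₃' ≤ z * (b + 1) := Nat.mul_le_mul_left z hc
  have h2 : D' + z * c₃' + extra ≤
      (a + (k + 2) * b + c + (w + k)) + z * (b + 1) + ((k + z + 1) * c + (w + 1)) :=
    Nat.add_le_add (Nat.add_le_add hD' h1) hextra
  have h3 : (a + (k + 2) * b + c + (w + k)) + z * (b + 1) + ((k + z + 1) * c + (w + 1)) ≤
      a + b + (k + z + 1) * (b + c) + (c + (w + 1)) + (w + k + z) := le_of_eq (by ring)
  exact hD.trans (h2.trans h3)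

/-- **THE SERIES-CLASS STEP** (degenerate sub-case `m = w + 2`, the complement a line): from `D ≤ D' + z·c₃' + extra`,
`D' ≤ B(w, m) + (m − 3)`, `c₃' ≤ C(w + 2, 3)` and `extra ≤ n − 1` (`m + z = n`, `z ≥ 3`), conclude
`D ≤ B(w + 1, n) + (n − 3)`. -/
theorem depFour_caseA_crude {w n m z D D' c₃' extra : ℕ} (hw : 1 ≤ w) (hmz : m + z = n) (hm : m = w + 2)
    (hz : 3 ≤ z)
    (hD : D ≤ D' + z * c₃' + extra)
    (hD' : D' ≤ (w + 1).choose 4 + (m - w - 1) * (w + 1).choose 3 + (w + 1).choose 2 + (m - 3))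
    (hc : c₃' ≤ (w + 2).choose 3) (hextra : extra ≤ n - 1) :
    D ≤ (w + 2).choose 4 + (n - (w + 1) - 1) * (w + 2).choose 3 + (w + 2).choose 2 + (n - 3) := by
  obtain ⟨p4, p3, p2⟩ := choose_pascal w
  rw [p4, p3, p2]
  rw [p3] at hc
  subst hm
  subst hmz
  have e1 : w + 2 - w - 1 = 1 := by omega
  have e2 : w + 2 + z - (w + 1) - 1 = z := by omega
  have e3 : w + 2 + z - 1 = w + z + 1 := by omega
  have e4 : w + 2 + z - 3 = w + z - 1 := by omega
  have e5 : w + 2 - 3 = w - 1 := by omega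
  rw [e1, e5] at hD'
  rw [e2, e4]
  rw [e3] at hextra
  set a := (w + 1).choose 4
  set b := (w + 1).choose 3
  set c := (w + 1).choose 2
  have h1 : z * c₃' ≤ z * (b + c) := Nat.mul_le_mul_left z hc
  have h2 : D' + z * c₃' + extra ≤ (a + 1 * b + c + (w - 1)) + z * (b + c) + (w + z + 1) :=
    Nat.add_le_add (Nat.add_le_add hD' h1) hextra
  have h3 : (a + 1 * b + c + (w - 1)) + z * (b + c) + (w + z + 1) ≤
      a + b + z * (b + c) + (c + (w + 1)) + (w + z - 1) := by
    obtain ⟨w', rfl⟩ : ∃ w', w = w' + 1 := ⟨w - 1, by omega⟩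
    have e6 : w' + 1 - 1 = w' := by omega
    have e7 : w' + 1 + z - 1 = w' + z := by omega
    rw [e6, e7]
    exact le_of_eq (by ring)
  exact hD.trans (h2.trans h3)

/-- The `|Z| = 2` bound: `(n − 3) + q ≤ (n − w − 2)·C(w + 1, 2) + (w + 1)` when `2q ≤ (n − 2)·w`, `w ≥ 2`, `n ≥ w + 5`. -/
theorem extra_two_le {w n q : ℕ} (hw : 2 ≤ w) (hn : w + 5 ≤ n) (hq : 2 * q ≤ (n - 2) * w) :
    (n - 3) + q ≤ (n - w - 2) * (w + 1).choose 2 + (w + 1) := by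
  obtain ⟨t, rfl⟩ : ∃ t, w = t + 2 := ⟨w - 2, by omega⟩
  obtain ⟨s, rfl⟩ : ∃ s, n = t + s + 7 := ⟨n - t - 7, by omega⟩
  have h2 : (t + 3).choose 2 * 2 = (t + 3) * (t + 2) := (choose_relations t).2.2
  have e1 : t + s + 7 - 3 = t + s + 4 := by omega
  have e2 : t + s + 7 - (t + 2) - 2 = s + 3 := by omega
  have e3 : t + s + 7 - 2 = t + s + 5 := by omega
  rw [e1, e2, show t + 2 + 1 = t + 3 by rfl]
  rw [e3] at hq
  set c := (t + 3).choose 2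
  have h2' : (s + 3) * (c * 2) = (s + 3) * ((t + 3) * (t + 2)) := by rw [h2]
  nlinarith [hq, h2', Nat.zero_le (s * t * t), Nat.zero_le (s * t), Nat.zero_le (t * t), Nat.zero_le s,
    Nat.zero_le t]

/-- The `|Z| = 3` bound: `n − 3 ≤ (n − w − 2)·C(w + 1, 2) + (w + 1)` for `w ≥ 2`, `n ≥ w + 5`. -/
theorem extra_three_le {w n : ℕ} (hw : 2 ≤ w) (hn : w + 5 ≤ n) :
    n - 3 ≤ (n - w - 2) * (w + 1).choose 2 + (w + 1) := by
  have hc : 3 ≤ (w + 1).choose 2 := by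
    have := Nat.choose_le_choose 2 (show 3 ≤ w + 1 by omega)
    simpa using this
  have : (n - w - 2) * 3 ≤ (n - w - 2) * (w + 1).choose 2 := Nat.mul_le_mul_left _ hc
  omega

/-- **THE BASE `ν = 2`**: `2·(n − 3) + n / (n − 4) ≤ 2n − 3` for `n ≥ 6`, and `B(2, n) + (n − 3) = 2n − 3`. -/
theorem depFour_base_large {n D c₃ c₄ : ℕ} (hn : 6 ≤ n) (hD : D ≤ (n - 3) * c₃ + c₄) (hc₃ : c₃ ≤ 2)
    (hc₄ : c₄ ≤ n * (2 + 2).choose 4 / (n - 4)) :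
    D ≤ (2 + 1).choose 4 + (n - 2 - 1) * (2 + 1).choose 3 + (2 + 1).choose 2 + (n - 3) := by
  have h4 : (2 + 2).choose 4 = 1 := by decide
  rw [h4, mul_one] at hc₄
  have hdiv : n / (n - 4) ≤ 3 := by
    rw [Nat.div_le_iff_le_mul_add_pred (by omega)]
    omega
  have : (n - 3) * c₃ ≤ (n - 3) * 2 := Nat.mul_le_mul_left _ hc₃
  simp only [show (2 + 1).choose 4 = 0 by decide, show (2 + 1).choose 3 = 1 by decide,
    show (2 + 1).choose 2 = 3 by decide]
  omega

/-- **THE BASE `ν = 2`, small `n`**: `C(n, 4) ≤ B(2, n) + (n − 3)` for `n ≤ 5`. -/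
theorem depFour_base_small {n : ℕ} (hn : n ≤ 5) :
    n.choose 4 ≤ (2 + 1).choose 4 + (n - 2 - 1) * (2 + 1).choose 3 + (2 + 1).choose 2 + (n - 3) := by
  interval_cases n <;> decide

end S1CFG

end PercRepro
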